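import Mathlib
import Summits.NavierStokesRegularity.NavierStokesRegularity.Theorems.EulerZoomLiouvillePowerGaugeEulerLiouvilleSelfSimilarFiniteHyperbolic
import HarnessLib

/-!
# Rung C1 of the crux `EulerZoomLiouville.PowerGaugeEulerLiouville`: DRIFT CONTROL — a backward trajectory that
# accumulates on a piece of the stagnation set carrying a «drift coordinate» converges to a SINGLE stagnation point
# (route №10, item stmt-NavierStokesRegularity-19832; `--supports`)

Helper file (theorems only). Seat ns-typeII-p3 (cell ns-regularity-ideate §B, D-0081).  After typeII-p2's
`NodalFiniteness.eq_zero_of_countable_nodalSet` the classical residue of rung C1 is: in-window profiles whose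
stagnation set `𝒩_W` is UNCOUNTABLE (continua: stagnation curves / surfaces).  Every exclusion mechanism in the tree
(KILL certificates, THIN cone lemmas `UnstableSetNull` / `DominatedUnstableSetNull`, the Baire assembly) consumes
backward trajectories that CONVERGE to one node or stay near one node; on a continuum of nodes a trajectory may a
priori DRIFT along the continuum forever.  This file isolates the analytic fact that forbids the drift in our
gradient-like setting — the Bernoulli function gives `∫_{−∞}^0 ‖W(Φ_s x)‖² ds < ∞`, so any quantity whose speed along
the flow is `O(‖W‖²)` converges:

* `exists_forall_le_mem_of_mapClusterPt_subset` — if every backward cluster point of `x` lies in the open set `U`,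
  the backward trajectory is eventually in `U` (precompact tail);
* `integrableOn_norm_transport_sq_backward` — `t ↦ ‖W(Φ_{−t} x)‖²` is integrable on `(T₀, ∞)`
  (`exists_integral_norm_transport_sq_le`: `ℋ` is a bounded Lyapunov function along bounded backward trajectories);
* **`tendsto_driftCoordinate_flow_atBot`** — if `f` is `C¹` with `‖Df(y) W(y)‖ ≤ C ‖W(y)‖²` on `U`, then
  `f(Φ_s x)` converges as `s → −∞`;
* **`tendsto_flow_atBot_of_driftCoordinate`** — if moreover `f` is injective on `𝒩_W ∩ U`, the backward trajectory
  of `x` CONVERGES to a single stagnation point (all cluster points are nodes in `U` with the same `f`-value).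

A «drift coordinate» exists near a TRANSVERSALLY NONDEGENERATE stagnation curve `Γ` (`rank DW = 2` on `Γ`,
`ker DW(z) = T_zΓ`): any `C¹` map `f` constant on the fibres of a tubular projection onto `Γ` has `Df(z) ∘ DW(z) = 0`
on `Γ`, whence `‖Df(y)W(y)‖ = O(dist(y,Γ)²) = O(‖W(y)‖²)`; this is the abstract content of Aulbach's theorem
(LNM 1058 (1984) Thm 2.3: trajectories accumulating on a normally hyperbolic manifold of equilibria converge to one
of them), obtained here without invariant-manifold theory because `ℋ` supplies `∫‖W‖² < ∞`.  Combined with the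
dominated cone lemma (`Literature.Dynamics.FixedPoints.hausdorffMeasure_localTrappedSet_eq_zero_of_dominated`) it is
the route to «orbits feeding a transversally-saddle stagnation curve form a null set».

WHAT THIS IS NOT: not NS, not E, not rung C1 — a convergence lemma for backward trajectories of classical in-window
profiles (`0 < γ < ½`, `V` smooth bounded, `‖DV‖ ≤ K`, `P` bounded above); the drift coordinate is a HYPOTHESIS.
[folklore; cf. Aulbach1984 Thm 2.3 (the statement; our proof is different); ConstantinIgnatovaVicol2026Putative
§3.4.3 (3.31) (ℋ as Lyapunov function)]
-/

noncomputable section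

-- flat `Theorems/<Route><Decl>…` files of one crux share the namespace of the crux (tree convention)
set_option linter.dupNamespace false

open MeasureTheory Set Filter Topology Metric Function InnerProductSpace
open scoped RealInnerProductSpace NNReal ContDiff

namespace Summit.NavierStokesRegularity.NavierStokesRegularity.Theorems.PowerGaugeEulerLiouville.Kelvin

open Literature.Analysis Literature.Analysis.FluidPDE

variable {γ : ℝ} {V : EuclideanSpace ℝ (Fin 3) → EuclideanSpace ℝ (Fin 3)} {P : EuclideanSpace ℝ (Fin 3) → ℝ}

/-! ### Backward trajectories enter any open set containing their cluster points -/

/-- **If every backward cluster point lies in the open set `U`, the backward trajectory is eventually in `U`**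
(`0 < γ < ½`: backward trajectories are bounded, so outside `U` they would accumulate in the compact set
`B̄(0, B) ∖ U`). [folklore] -/
theorem exists_forall_le_mem_of_mapClusterPt_subset (hV : ContDiff ℝ ∞ V) {K : ℝ} (hK : ∀ y, ‖fderiv ℝ V y‖ ≤ K)
    (hprof : IsSelfSimilarEulerProfile γ 0 V P) {M P₀ : ℝ} (hM : ∀ y, ‖V y‖ ≤ M) (hP : ∀ y, P y ≤ P₀)
    (hγ : 0 < γ) (hγ2 : γ < 1 / 2) (x : EuclideanSpace ℝ (Fin 3)) {U : Set (EuclideanSpace ℝ (Fin 3))}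
    (hU : IsOpen U)
    (hclU : ∀ z, MapClusterPt z atBot (fun s => ODE.evolutionMap (fun _ : ℝ => selfSimilarTransport γ 0 V) 0 s x) →
      z ∈ U) :
    ∃ S : ℝ, ∀ s ≤ S, ODE.evolutionMap (fun _ : ℝ => selfSimilarTransport γ 0 V) 0 s x ∈ U := by
  set Φ := ODE.evolutionMap (fun _ : ℝ => selfSimilarTransport γ 0 V) 0 with hΦ
  set B : ℝ := max 1 ((γ * M + |1 / 2 * M ^ 2 + P₀| + |selfSimilarBernoulli γ 0 V P x| + 1) / (γ * (1 / 2 - γ)))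
    with hB
  have hKc : IsCompact (closedBall (0 : EuclideanSpace ℝ (Fin 3)) B \ U) := (isCompact_closedBall 0 B).diff hU
  have htail : ∀ᶠ s in atBot, Φ s x ∈ closedBall (0 : EuclideanSpace ℝ (Fin 3)) B := by
    filter_upwards [eventually_le_atBot (0 : ℝ)] with s hs
    rw [mem_closedBall, dist_zero_right, hB]
    exact norm_flow_le_of_nonpos hV hK hprof hM hP hγ hγ2 x hs
  have hev : ∀ᶠ s in atBot, Φ s x ∈ U := by
    by_contra hnot
    have hfreq : ∃ᶠ s in atBot, Φ s x ∈ closedBall (0 : EuclideanSpace ℝ (Fin 3)) B \ U := by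
      have h1 : ∃ᶠ s in atBot, Φ s x ∉ U := not_eventually.1 hnot
      exact (h1.and_eventually htail).mono fun s hs => ⟨hs.2, hs.1⟩
    obtain ⟨z, hz, hcl⟩ := hKc.exists_mapClusterPt_of_frequently hfreq
    exact hz.2 (hclU z hcl)
  obtain ⟨S, hS⟩ := eventually_atBot.1 hev
  exact ⟨S, hS⟩

/-! ### Square-integrability of the speed along backward trajectories -/

/-- **`‖W(Φ_{−t} x)‖²` is integrable on `(0, ∞)`** (`0 < γ < ½`): the Bernoulli function is a bounded strict
Lyapunov function along the bounded backward trajectory (`exists_integral_norm_transport_sq_le`).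
[cite: ConstantinIgnatovaVicol2026Putative, §3.4.3 eq. (3.31)] -/
theorem integrableOn_norm_transport_sq_backward (hV : ContDiff ℝ ∞ V) {K : ℝ} (hK : ∀ y, ‖fderiv ℝ V y‖ ≤ K)
    (hprof : IsSelfSimilarEulerProfile γ 0 V P) {M P₀ : ℝ} (hM : ∀ y, ‖V y‖ ≤ M) (hP : ∀ y, P y ≤ P₀)
    (hγ : 0 < γ) (hγ2 : γ < 1 / 2) (x : EuclideanSpace ℝ (Fin 3)) :
    IntegrableOn (fun t : ℝ => ‖selfSimilarTransport γ 0 V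
      (ODE.evolutionMap (fun _ : ℝ => selfSimilarTransport γ 0 V) 0 (-t) x)‖ ^ 2) (Ioi 0) := by
  have hY := hasDerivAt_flow_neg (γ := γ) hV hK x
  have hBd : ∀ t : ℝ, 0 ≤ t → ‖ODE.evolutionMap (fun _ : ℝ => selfSimilarTransport γ 0 V) 0 (-t) x‖ ≤
      max 1 ((γ * M + |1 / 2 * M ^ 2 + P₀| + |selfSimilarBernoulli γ 0 V P x| + 1) / (γ * (1 / 2 - γ))) :=
    fun t ht => norm_flow_le_of_nonpos hV hK hprof hM hP hγ hγ2 x (by linarith)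
  obtain ⟨C, hC⟩ := hprof.exists_integral_norm_transport_sq_le (ne_of_lt hγ2) (σ := -1) (by norm_num) hY hBd
  have hcont : Continuous fun t : ℝ => ‖selfSimilarTransport γ 0 V
      (ODE.evolutionMap (fun _ : ℝ => selfSimilarTransport γ 0 V) 0 (-t) x)‖ ^ 2 :=
    (((contDiff_selfSimilarTransport (γ := γ) hV).continuous.comp
      ((continuous_flow_apply (γ := γ) hV hK x).comp continuous_neg)).norm).pow 2
  refine integrableOn_Ioi_of_intervalIntegral_norm_bounded C 0 (l := atTop) (b := fun n : ℕ => (n : ℝ))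
    (fun n => (hcont.integrableOn_Icc).mono_set Ioc_subset_Icc_self) tendsto_natCast_atTop_atTop ?_
  refine Eventually.of_forall fun n => ?_
  have h := hC 0 n le_rfl (Nat.cast_nonneg n)
  refine le_trans (le_of_eq ?_) h
  refine intervalIntegral.integral_congr fun t _ => ?_
  simp only [Real.norm_eq_abs, abs_pow, abs_norm]

/-! ### Drift coordinates converge along backward trajectories -/

/-- **A drift coordinate converges along the backward trajectory.**  Let `f` be `C¹` with
`‖Df(y) W(y)‖ ≤ C‖W(y)‖²` on an open set `U` containing every backward cluster point of `x`.  Then `f(Φ_s x)`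
converges as `s → −∞` (its speed is integrable: `∫‖W‖² < ∞`). [folklore; cf. Aulbach1984 Thm 2.3] -/
theorem tendsto_driftCoordinate_flow_atBot (hV : ContDiff ℝ ∞ V) {K : ℝ} (hK : ∀ y, ‖fderiv ℝ V y‖ ≤ K)
    (hprof : IsSelfSimilarEulerProfile γ 0 V P) {M P₀ : ℝ} (hM : ∀ y, ‖V y‖ ≤ M) (hP : ∀ y, P y ≤ P₀)
    (hγ : 0 < γ) (hγ2 : γ < 1 / 2) (x : EuclideanSpace ℝ (Fin 3)) {U : Set (EuclideanSpace ℝ (Fin 3))}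
    (hU : IsOpen U)
    (hclU : ∀ z, MapClusterPt z atBot (fun s => ODE.evolutionMap (fun _ : ℝ => selfSimilarTransport γ 0 V) 0 s x) →
      z ∈ U)
    {F' : Type*} [NormedAddCommGroup F'] [NormedSpace ℝ F'] [CompleteSpace F']
    {f : EuclideanSpace ℝ (Fin 3) → F'} (hf : ContDiff ℝ 1 f) {C : ℝ}
    (hdrift : ∀ y ∈ U, ‖fderiv ℝ f y (selfSimilarTransport γ 0 V y)‖ ≤ C * ‖selfSimilarTransport γ 0 V y‖ ^ 2) :
    ∃ ℓ : F', Tendsto (fun s => f (ODE.evolutionMap (fun _ : ℝ => selfSimilarTransport γ 0 V) 0 s x))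
      atBot (𝓝 ℓ) := by
  set Φ := ODE.evolutionMap (fun _ : ℝ => selfSimilarTransport γ 0 V) 0 with hΦ
  obtain ⟨S, hS⟩ := exists_forall_le_mem_of_mapClusterPt_subset hV hK hprof hM hP hγ hγ2 x hU hclU
  -- work in the backward time `t = −s ≥ T₀ := max (−S) 0`
  set T₀ : ℝ := max (-S) 0 with hT₀
  set G : ℝ → F' := fun t => f (Φ (-t) x) with hG
  set G' : ℝ → F' := fun t => -(fderiv ℝ f (Φ (-t) x) (selfSimilarTransport γ 0 V (Φ (-t) x))) with hG'
  have hGd : ∀ t, HasDerivAt G (G' t) t := by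
    intro t
    have h := ((hf.differentiable one_ne_zero) _).hasFDerivAt.comp_hasDerivAt t
      (hasDerivAt_flow_neg (γ := γ) hV hK x t)
    have e : fderiv ℝ f (Φ (-t) x) ((-1 : ℝ) • selfSimilarTransport γ 0 V (Φ (-t) x)) = G' t := by
      rw [hG', map_smul, neg_one_smul]
    exact h.congr_deriv e
  have hWc : Continuous fun t => selfSimilarTransport γ 0 V (Φ (-t) x) :=
    (contDiff_selfSimilarTransport (γ := γ) hV).continuous.comp
      ((continuous_flow_apply (γ := γ) hV hK x).comp continuous_neg)
  have hG'c : Continuous G' := by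
    have h1 : Continuous fun t => fderiv ℝ f (Φ (-t) x) :=
      (hf.continuous_fderiv one_ne_zero).comp ((continuous_flow_apply (γ := γ) hV hK x).comp continuous_neg)
    exact (h1.clm_apply hWc).neg
  -- `‖G' t‖ ≤ C ‖W(Φ_{−t} x)‖²` for `t ≥ T₀`
  have hG'le : ∀ t, T₀ ≤ t → ‖G' t‖ ≤ C * ‖selfSimilarTransport γ 0 V (Φ (-t) x)‖ ^ 2 := by
    intro t ht
    have hmem : Φ (-t) x ∈ U := hS _ (by rw [hT₀] at ht; linarith [le_max_left (-S) 0])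
    have h := hdrift _ hmem
    simp only [hG', norm_neg]
    exact h
  -- `G'` is integrable on `(T₀, ∞)`
  have hω := integrableOn_norm_transport_sq_backward hV hK hprof hM hP hγ hγ2 x
  have hG'int : IntegrableOn G' (Ioi T₀) := by
    have hωT : IntegrableOn (fun t : ℝ => C * ‖selfSimilarTransport γ 0 V (Φ (-t) x)‖ ^ 2) (Ioi T₀) :=
      (hω.mono_set (Ioi_subset_Ioi (le_max_right _ _))).const_mul C
    refine Integrable.mono' hωT hG'c.aestronglyMeasurable ?_
    refine (ae_restrict_mem measurableSet_Ioi).mono fun t ht => hG'le t (le_of_lt ht)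
  -- FTC: `G t = G T₀ + ∫_{T₀}^t G'`, and the integral converges
  have hFTC : ∀ t, G t = G T₀ + ∫ τ in T₀..t, G' τ := by
    intro t
    have h := intervalIntegral.integral_eq_sub_of_hasDerivAt (fun τ _ => hGd τ) (hG'c.intervalIntegrable T₀ t)
    rw [h]; abel
  have hlim : Tendsto (fun t => ∫ τ in T₀..t, G' τ) atTop (𝓝 (∫ τ in Ioi T₀, G' τ)) :=
    intervalIntegral_tendsto_integral_Ioi T₀ hG'int tendsto_id
  refine ⟨G T₀ + ∫ τ in Ioi T₀, G' τ, ?_⟩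
  have hGlim : Tendsto G atTop (𝓝 (G T₀ + ∫ τ in Ioi T₀, G' τ)) := by
    have h := hlim.const_add (G T₀)
    exact h.congr fun t => (hFTC t).symm
  have h := hGlim.comp tendsto_neg_atBot_atTop
  refine h.congr fun s => ?_
  simp only [hG, Function.comp_apply, neg_neg]

/-- **SINGLE-POINT CONVERGENCE FROM A DRIFT COORDINATE.**  Let `(V, P)` be a classical in-window profile
(`0 < γ < ½`, `V` smooth bounded, `‖DV‖ ≤ K`, `P` bounded above) and `x` any point.  Suppose an open set `U`
contains every backward cluster point of `x` and carries a `C¹` map `f` (values in a complete normed space) with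
`‖Df(y) W(y)‖ ≤ C‖W(y)‖²` on `U` which is INJECTIVE on `𝒩_W ∩ U`.  Then the backward trajectory of `x` converges to a
single stagnation point.  (All cluster points are stagnation points in `U` with the common value `lim f(Φ_s x)`.)
[folklore; cf. Aulbach1984 Thm 2.3 (convergence to one equilibrium near a normally hyperbolic manifold of equilibria)] -/
theorem tendsto_flow_atBot_of_driftCoordinate (hV : ContDiff ℝ ∞ V) {K : ℝ} (hK : ∀ y, ‖fderiv ℝ V y‖ ≤ K)
    (hprof : IsSelfSimilarEulerProfile γ 0 V P) {M P₀ : ℝ} (hM : ∀ y, ‖V y‖ ≤ M) (hP : ∀ y, P y ≤ P₀)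
    (hγ : 0 < γ) (hγ2 : γ < 1 / 2) (x : EuclideanSpace ℝ (Fin 3)) {U : Set (EuclideanSpace ℝ (Fin 3))}
    (hU : IsOpen U)
    (hclU : ∀ z, MapClusterPt z atBot (fun s => ODE.evolutionMap (fun _ : ℝ => selfSimilarTransport γ 0 V) 0 s x) →
      z ∈ U)
    {F' : Type*} [NormedAddCommGroup F'] [NormedSpace ℝ F'] [CompleteSpace F']
    {f : EuclideanSpace ℝ (Fin 3) → F'} (hf : ContDiff ℝ 1 f) {C : ℝ}
    (hdrift : ∀ y ∈ U, ‖fderiv ℝ f y (selfSimilarTransport γ 0 V y)‖ ≤ C * ‖selfSimilarTransport γ 0 V y‖ ^ 2)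
    (hinj : InjOn f (selfSimilarNodalSet γ 0 V ∩ U)) :
    ∃ z ∈ selfSimilarNodalSet γ 0 V,
      Tendsto (fun s => ODE.evolutionMap (fun _ : ℝ => selfSimilarTransport γ 0 V) 0 s x) atBot (𝓝 z) := by
  set Φ := ODE.evolutionMap (fun _ : ℝ => selfSimilarTransport γ 0 V) 0 with hΦ
  obtain ⟨ℓ, hℓ⟩ := tendsto_driftCoordinate_flow_atBot hV hK hprof hM hP hγ hγ2 x hU hclU hf hdrift
  -- every cluster point has `f`-value `ℓ`
  have hval : ∀ z, MapClusterPt z atBot (fun s => Φ s x) → f z = ℓ := by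
    intro z hz
    have h1 : MapClusterPt (f z) atBot (f ∘ fun s => Φ s x) := hz.continuousAt_comp hf.continuous.continuousAt
    exact eq_of_nhds_neBot (h1.clusterPt.mono hℓ)
  -- the tail lies in a compact ball; a cluster point exists
  set B : ℝ := max 1 ((γ * M + |1 / 2 * M ^ 2 + P₀| + |selfSimilarBernoulli γ 0 V P x| + 1) / (γ * (1 / 2 - γ)))
    with hB
  have hKc : IsCompact (closedBall (0 : EuclideanSpace ℝ (Fin 3)) B) := isCompact_closedBall 0 B
  have htail : ∀ᶠ s in atBot, Φ s x ∈ closedBall (0 : EuclideanSpace ℝ (Fin 3)) B := by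
    filter_upwards [eventually_le_atBot (0 : ℝ)] with s hs
    rw [mem_closedBall, dist_zero_right, hB]
    exact norm_flow_le_of_nonpos hV hK hprof hM hP hγ hγ2 x hs
  obtain ⟨z, -, hz⟩ := hKc.exists_mapClusterPt_of_frequently htail.frequently
  have hzN : z ∈ selfSimilarNodalSet γ 0 V := mem_nodalSet_of_mapClusterPt_atBot hV hK hprof hM hP hγ hγ2 hz
  refine ⟨z, hzN, hKc.tendsto_nhds_of_unique_mapClusterPt htail fun z' _ hz' => ?_⟩
  have hz'N : z' ∈ selfSimilarNodalSet γ 0 V := mem_nodalSet_of_mapClusterPt_atBot hV hK hprof hM hP hγ hγ2 hz'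
  exact hinj ⟨hz'N, hclU z' hz'⟩ ⟨hzN, hclU z hz⟩ ((hval z' hz').trans (hval z hz).symm)

end Summit.NavierStokesRegularity.NavierStokesRegularity.Theorems.PowerGaugeEulerLiouville.Kelvin

end
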